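import Literature.AlgebraicGeometry.Frobenioids.ArchimedeanFSMMonoCondBN
import HarnessLib

/-!
# Frobenioids II, Proposition 3.4 (ii) under condition (b), for the rigidified angloid `R`, and
# Proposition 3.4 (ii) for `F = A, N, R`: PROOF
# (abc-iut cell, layer L1, node `FrdII:Prop3.4(ii)`, sub-nodes P34-L02/L03, chain LC-L1-2)

Mochizuki, *The geometry of Frobenioids II: poly-Frobenioids*, Kyushu J. Math. **62** (2008)
401–460, §3, Proposition 3.4 (ii) p. 30, proof pp. 30–31 [cite: MochizukiFrdII2008, Prop 3.4 (ii) p.30].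
PROOF-ONLY companion of `ArchimedeanFSM.lean` (statements, abc-iut-L1-t6); nothing is defined here.

The tower `R = R₀ ×_{D₀} D` (`R₀ = (N₀)_{[ℝ-unit]}`, words read through `C`): the argument of the `A` and
`N` files with the slice bookkeeping (`Over N0.realUnit`): (Step 1) co-angularity of the Frobenius-type
factor of condition (b), tested inside `R`; (Step 2) the isotropic hull of `X′` inside `R` (the object
with full angular part, structure arrow to the real unit extended from that of `X′`); (Step 3/4) the
conjugate pair of `ArchimedeanLargeArcs.lean` lifted to `R` over `α_D, β_D`, and `φ` mono. Results:
`R.propII : (towerR π).PropII`, and the item for the three towers,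
**`prop34_ii_holds : Prop34_ii π`** — [FrdII] Prop. 3.4 (ii) AS TYPED (condition (a): abc-iut-L1-d3's
`ArchimedeanFSMMono.lean` route; condition (b): these files). No statement of the paper is
strengthened; no side is taken on [IUTchIII] Cor. 3.12.
-/

namespace Literature.AlgebraicGeometry.Frobenioids

open CategoryTheory Set
open scoped Pointwise

noncomputable section

namespace ArchFrd

universe v u

/-! ### `C₀`: the conjugate pair for an arbitrary complex source and real target -/

/-- `ArchFrd.C0.exists_conj_pair_of_compl_subset` for objects GIVEN as arbitrary `X₀` (complex) and
`Y₀` (real) of `C₀`: the conjugate linear isometries `a₀` (untwisted base) and `b₀` (twisted base) from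
an object over `Base(X₀)` with `φ₀ a₀ = φ₀ b₀`. [cite: MochizukiFrdII2008, Prop 3.4 (ii) p.30] -/
theorem C0.exists_conj_pair_of_compl_subset' (X₀ Y₀ : C0) (hX : X₀.base = D0.complex)
    (hY : Y₀.base = D0.real) (φ : X₀ ⟶ Y₀) {e q : ↥(normOneSubgroup ℂ)}
    (hbig : ({q}ᶜ : Set ↥(normOneSubgroup ℂ)) ⊆ e • X₀.region.dir ^ (C0.degFr φ : ℕ)) :
    ∃ (RZ : AngularRegion ℂ) (hRZ : X₀.base = D0.real → RZ.IsIsotropic)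
      (a b : C0.mk X₀.base RZ hRZ ⟶ X₀),
      C0.Base a = 𝟙 _ ∧ D0.Hom.twists (C0.Base b) = true ∧ C0.degFr a = 1 ∧ C0.degFr b = 1 ∧
        PreFrobenioid.IsIsometry C0.toElem a ∧ PreFrobenioid.IsIsometry C0.toElem b ∧
          a ≫ φ = b ≫ φ := by
  obtain ⟨KX, RX, hRX⟩ := X₀
  obtain ⟨KY, RY, hRY⟩ := Y₀
  cases hX
  cases hY
  obtain ⟨RZ, hRZ, a, b, hab, hbb, had, hbd, hai, hbi, hcomp⟩ :=
    C0.exists_conj_pair_of_compl_subset RX hRX RY hRY φ hbig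
  exact ⟨RZ, hRZ, a, b, hab, by rw [hbb]; rfl, had, hbd, hai, hbi, hcomp⟩

variable {D : Type u} [Category.{v} D] (π : D ⥤ D0)

/-! ### The tower `R`: isotropic objects and the full-angular-part object -/

/-- An object of `R` whose underlying `C₀`-object has full angular part is isotropic (words through
`C`). [cite: MochizukiFrdII2008, Ex 3.3 (iv) p.29] -/
theorem R.isIsotropic_of_isNaivelyIsotropic (W : R π)
    (hW : W.fst.left.obj.obj.IsNaivelyIsotropic) :
    PreFrobenioid.IsIsotropic (R.toC π ⋙ C.toElem π) W := by
  intro V ψ hiso hpre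
  have hbi : IsIso ψ.snd := hpre.2
  haveI : IsIso (C0.Base (N0.homCarrier ψ.fst.left)) := R.isIso_base0_of_isIso_toD π ψ hbi
  have hψ₀ : PreFrobenioid.IsIsometry C0.toElem (N0.homCarrier ψ.fst.left) := ψ.fst.left.hom.property
  haveI : IsIso (N0.homCarrier ψ.fst.left) := C0.isIso_of_isIsotropic _ hW ψ.fst.left.property
    ((A0.isIsometry_iff_norm_mul_tip_pow _).mp hψ₀)
  haveI : IsIso ψ.fst.left := N0.isIso_of_isIso_carrier ψ.fst.left
  haveI : IsIso ((Over.forget N0.realUnit).map ψ.fst) := by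
    change IsIso ψ.fst.left; infer_instance
  haveI : IsIso ψ.fst := isIso_of_reflects_iso ψ.fst (Over.forget N0.realUnit)
  haveI : IsIso ψ.snd := hbi
  exact CFP.isIso_of_isIso_fst_snd ψ

/-- For `X′ ∈ Ob(R)`: the object of `R` with the same base, `D`-component, tip and structure scalar and
FULL angular part, the linear isometry `h` into it over identities, and: `h` is an isometric pre-step of
`R`; `h` is an isotropic hull IN `R`; if `h` is invertible then `X′` has full angular part.
[cite: MochizukiFrdII2008, Prop 3.4 (ii) p.30] -/
theorem R.exists_full_inclusion (X' : R π) :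
    ∃ (X'' : R π) (h : X' ⟶ X''),
      PreFrobenioid.IsIsometry (R.toC π ⋙ C.toElem π) h ∧
      PreFrobenioid.IsPreStep (R.toC π ⋙ C.toElem π) h ∧
      (IsIso h → X'.fst.left.obj.obj.IsNaivelyIsotropic) ∧
      ((∀ W : R π, PreFrobenioid.IsIsotropic (R.toC π ⋙ C.toElem π) W →
          W.fst.left.obj.obj.IsNaivelyIsotropic) →
        PreFrobenioid.IsIsotropicHull (R.toC π ⋙ C.toElem π) h) := by
  obtain ⟨rX', X'D, ιX'⟩ := X'
  -- notation for the underlying data of `rX'`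
  have hsiso : PreFrobenioid.IsIsometry C0.toElem (N0.homCarrier rX'.hom) := rX'.hom.hom.property
  have hslin : C0.degFr (N0.homCarrier rX'.hom) = 1 := rX'.hom.property
  have hseq := (A0.isIsometry_iff_norm_mul_tip_pow _).mp hsiso
  have hU : N0.realUnit.carrier.IsNaivelyIsotropic :=
    C0.isNaivelyIsotropic_of_isRealObj N0.isRealObj_realUnit
  -- the full object and the inclusion at the level of `C₀`
  let X'₀ : C0 := rX'.left.obj.obj
  let F₀ : C0 := ⟨X'₀.base, AngularRegion.isotropicOfTip X'₀.region.tip,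
    fun _ => AngularRegion.isIsotropic_isotropicOfTip _⟩
  have hF₀ : F₀.IsNaivelyIsotropic := AngularRegion.isIsotropic_isotropicOfTip _
  have hmh : (1 : ℂˣ) • X'₀.region.carrier ^ ((1 : ℕ+) : ℕ) ⊆ C0.pullRegion F₀ (𝟙 X'₀.base) := by
    rw [one_smul, PNat.one_coe, pow_one, show (𝟙 X'₀.base) = 𝟙 F₀.base from rfl, C0.pullRegion_id]
    intro u hu
    rw [C0.mem_carrier_of_isIsotropic hF₀]
    exact ((X'₀.region.mem_carrier_polar_iff u).mp hu).2
  let h₀ : X'₀ ⟶ F₀ := ⟨𝟙 _, 1, 1, one_mem _, hmh⟩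
  have hh₀ : PreFrobenioid.IsIsometry C0.toElem h₀ := by
    rw [A0.isIsometry_iff_norm_mul_tip_pow]
    change ‖((1 : ℂˣ) : ℂ)‖ * X'₀.tip ^ ((1 : ℕ+) : ℕ) = X'₀.tip
    rw [Units.val_one, norm_one, one_mul, PNat.one_coe, pow_one]
  -- the structure arrow of the full object: the data of `rX'.hom` read on `F₀`
  have hms : (N0.homCarrier rX'.hom).scalar • F₀.region.carrier ^ ((N0.homCarrier rX'.hom).degFr : ℕ) ⊆
      C0.pullRegion N0.realUnit.carrier (N0.homCarrier rX'.hom).base := by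
    obtain ⟨PW, hPWc, hPWt, -, hPWi⟩ := exists_pulledRegion N0.realUnit.carrier (C0.Base (N0.homCarrier rX'.hom))
    obtain ⟨n, hn⟩ : ∃ n : ℕ, (C0.degFr (N0.homCarrier rX'.hom) : ℕ) = n + 1 :=
      ⟨_, (PNat.natPred_add_one _).symm⟩
    change C0.scalar _ • F₀.region.carrier ^ (C0.degFr (N0.homCarrier rX'.hom) : ℕ) ⊆
      C0.pullRegion N0.realUnit.carrier (C0.Base _)
    rw [← hPWc, hn, F₀.region.smul_carrier_pow_subset_iff PW _ n, show PW.dir = univ from hPWi hU]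
    refine ⟨subset_univ _, ?_⟩
    rw [AngularRegion.absHom_mul_pow_le_iff, hPWt, ← hn]
    exact hseq.le
  let s₀ : F₀ ⟶ N0.realUnit.carrier := ⟨(N0.homCarrier rX'.hom).base, (N0.homCarrier rX'.hom).degFr,
    (N0.homCarrier rX'.hom).scalar, (N0.homCarrier rX'.hom).scalar_mem, hms⟩
  have hs₀ : PreFrobenioid.IsIsometry C0.toElem s₀ := by
    rw [A0.isIsometry_iff_norm_mul_tip_pow]; exact hseq
  let sN : (⟨⟨F₀⟩⟩ : N0) ⟶ N0.realUnit := N0.homMk s₀ hs₀ hslin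
  have hfs : h₀ ≫ s₀ = N0.homCarrier rX'.hom := by
    refine C0.hom_ext ?_ ?_ ?_
    · change 𝟙 _ ≫ (N0.homCarrier rX'.hom).base = _; exact Category.id_comp _
    · change (1 : ℕ+) * _ = _; exact one_mul _
    · change D0.Hom.act (𝟙 X'₀.base) _ * 1 ^ _ = _
      rw [one_pow, mul_one]
      change D0.galAct (D0.Hom.twists (𝟙 X'₀.base)) _ = _
      rw [D0.twists_id, D0.galAct_false]
  let hN : rX'.left ⟶ (⟨⟨F₀⟩⟩ : N0) := N0.homMk h₀ hh₀ rfl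
  let rF : R0 := Over.mk sN
  let hO : rX' ⟶ rF := Over.homMk hN (N0.hom_ext hfs)
  let FR : R π := ⟨rF, X'D, ιX'⟩
  have wh : R0.toD0.map hO ≫ FR.iso.hom = ιX'.hom ≫ π.map (𝟙 X'D) := by
    change 𝟙 _ ≫ ιX'.hom = ιX'.hom ≫ π.map (𝟙 X'D)
    rw [CategoryTheory.Functor.map_id, Category.id_comp, Category.comp_id]
  let hR : (⟨rX', X'D, ιX'⟩ : R π) ⟶ FR := ⟨hO, 𝟙 X'D, wh⟩
  have hhR : PreFrobenioid.IsIsometry (R.toC π ⋙ C.toElem π) hR := by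
    change pull _ _ (PreFrobenioid.Div C0.toElem h₀) = 1
    rw [show PreFrobenioid.Div C0.toElem h₀ = 1 from hh₀, map_one]
  have hpre : PreFrobenioid.IsPreStep (R.toC π ⋙ C.toElem π) hR := by
    refine ⟨rfl, ?_⟩
    change IsIso (𝟙 X'D); infer_instance
  -- if `h` is invertible, `X′` has full angular part
  have hfull : IsIso hR → X'₀.IsNaivelyIsotropic := by
    intro hi
    haveI : IsIso ((R.toC π).map hR) := by haveI := hi; infer_instance
    haveI : IsIso h₀ := CFP.isIso_fst ((R.toC π).map hR)
    change X'₀.region.dir = univ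
    refine eq_univ_of_forall fun w => ?_
    have hmem : ((w : ↥(normOneSubgroup ℂ)) : ℂˣ) * ofPosReal ℂ X'₀.region.tip ∈ F₀.region.carrier := by
      rw [C0.mem_carrier_of_isIsotropic hF₀, map_mul, absHom_coe_normOne, one_mul, absHom_ofPosReal]
      exact le_rfl
    have h := C0.act_mem_carrier_of_isIso h₀ rfl rfl hmem
    change D0.galAct (D0.Hom.twists (𝟙 X'₀.base)) _ ∈ _ at h
    rw [D0.twists_id, D0.galAct_false, AngularRegion.coe_mul_ofPosReal_mem_carrier_iff] at h
    exact h.1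
  refine ⟨FR, hR, hhR, hpre, hfull, fun hdict => ⟨hhR, hpre, ?_, ?_⟩⟩
  · exact R.isIsotropic_of_isNaivelyIsotropic π FR hF₀
  · -- the universal property
    intro W γ hW
    have hWn : W.fst.left.obj.obj.IsNaivelyIsotropic := hdict W hW
    obtain ⟨rW, WD, ιW⟩ := W
    obtain ⟨γO, γD, wγ⟩ := γ
    change rW.left.obj.obj.IsNaivelyIsotropic at hWn
    let γ₀ : X'₀ ⟶ rW.left.obj.obj := N0.homCarrier γO.left
    have hγ₀ : PreFrobenioid.IsIsometry C0.toElem γ₀ := γO.left.hom.property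
    have hγlin : C0.degFr γ₀ = 1 := γO.left.property
    have hγeq := (A0.isIsometry_iff_norm_mul_tip_pow γ₀).mp hγ₀
    have hmγ' : γ₀.scalar • F₀.region.carrier ^ (γ₀.degFr : ℕ) ⊆ C0.pullRegion rW.left.obj.obj γ₀.base := by
      obtain ⟨PW, hPWc, hPWt, -, hPWi⟩ := exists_pulledRegion rW.left.obj.obj (C0.Base γ₀)
      obtain ⟨n, hn⟩ : ∃ n : ℕ, (C0.degFr γ₀ : ℕ) = n + 1 := ⟨_, (PNat.natPred_add_one _).symm⟩
      change C0.scalar γ₀ • F₀.region.carrier ^ (C0.degFr γ₀ : ℕ) ⊆ C0.pullRegion _ (C0.Base γ₀)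
      rw [← hPWc, hn, F₀.region.smul_carrier_pow_subset_iff PW (C0.scalar γ₀) n,
        show PW.dir = univ from hPWi hWn]
      refine ⟨subset_univ _, ?_⟩
      rw [AngularRegion.absHom_mul_pow_le_iff, hPWt, ← hn]
      exact hγeq.le
    let γ'₀ : F₀ ⟶ rW.left.obj.obj := ⟨γ₀.base, γ₀.degFr, γ₀.scalar, γ₀.scalar_mem, hmγ'⟩
    have hγ'₀ : PreFrobenioid.IsIsometry C0.toElem γ'₀ := by
      rw [A0.isIsometry_iff_norm_mul_tip_pow]; exact hγeq
    have hfacγ : h₀ ≫ γ'₀ = γ₀ := by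
      refine C0.hom_ext ?_ ?_ ?_
      · change 𝟙 _ ≫ γ₀.base = γ₀.base; exact Category.id_comp _
      · change (1 : ℕ+) * γ₀.degFr = γ₀.degFr; exact one_mul _
      · change D0.Hom.act (𝟙 X'₀.base) γ₀.scalar * 1 ^ (γ₀.degFr : ℕ) = γ₀.scalar
        rw [one_pow, mul_one]
        change D0.galAct (D0.Hom.twists (𝟙 X'₀.base)) γ₀.scalar = γ₀.scalar
        rw [D0.twists_id, D0.galAct_false]
    let γ'N : (⟨⟨F₀⟩⟩ : N0) ⟶ rW.left := N0.homMk γ'₀ hγ'₀ hγlin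
    -- compatibility with the structure arrows: cancel the epimorphism `h₀` of `C₀`
    have hγ'w : γ'N ≫ rW.hom = sN := by
      apply N0.hom_ext
      haveI : Epi h₀ := C0.isTotallyEpimorphic.epi h₀
      rw [N0.homCarrier_comp, ← cancel_epi h₀]
      change h₀ ≫ γ'₀ ≫ N0.homCarrier rW.hom = h₀ ≫ s₀
      rw [← Category.assoc, hfacγ, hfs]
      exact congrArg N0.homCarrier (Over.w γO)
    let γ'O : rF ⟶ rW := Over.homMk γ'N hγ'w
    have wγ' : R0.toD0.map γ'O ≫ ιW.hom = FR.iso.hom ≫ π.map γD := wγ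
    let γ'R : FR ⟶ ⟨rW, WD, ιW⟩ := ⟨γ'O, γD, wγ'⟩
    refine ⟨γ'R, ?_, ?_⟩
    · refine CFP.hom_ext (Over.OverMorphism.ext ?_) (Category.id_comp _)
      apply N0.hom_ext
      change h₀ ≫ γ'₀ = γ₀
      exact hfacγ
    · rintro ⟨γ''O, γ''D, wγ''⟩ hcomp
      have h1 : hO ≫ γ''O = γO := congrArg (fun k => k.fst) hcomp
      have h2 : 𝟙 X'D ≫ γ''D = γD := congrArg (fun k => k.snd) hcomp
      rw [Category.id_comp] at h2
      subst h2
      have h1' : h₀ ≫ N0.homCarrier γ''O.left = γ₀ := by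
        have := congrArg (fun k => N0.homCarrier k.left) h1
        exact this
      have h3 : N0.homCarrier γ''O.left = γ'₀ := by
        have hb : 𝟙 _ ≫ (N0.homCarrier γ''O.left).base = γ₀.base := congrArg C0.Hom.base h1'
        have hd : (1 : ℕ+) * (N0.homCarrier γ''O.left).degFr = γ₀.degFr := congrArg C0.Hom.degFr h1'
        have hs : D0.Hom.act (𝟙 X'₀.base) (N0.homCarrier γ''O.left).scalar *
            1 ^ ((N0.homCarrier γ''O.left).degFr : ℕ) = γ₀.scalar := congrArg C0.Hom.scalar h1'
        rw [Category.id_comp] at hb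
        rw [one_mul] at hd
        rw [one_pow, mul_one] at hs
        change D0.galAct (D0.Hom.twists (𝟙 X'₀.base)) _ = γ₀.scalar at hs
        rw [D0.twists_id, D0.galAct_false] at hs
        exact C0.hom_ext hb hd hs
      have h4 : γ''O = γ'O := Over.OverMorphism.ext (N0.hom_ext h3)
      subst h4
      rfl

/-- The isotropic objects of `R` (words through `C`) have full angular part.
[cite: MochizukiFrdII2008, Ex 3.3 (iv) p.29] -/
theorem R.isNaivelyIsotropic_of_isIsotropic (W : R π)
    (hW : PreFrobenioid.IsIsotropic (R.toC π ⋙ C.toElem π) W) :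
    W.fst.left.obj.obj.IsNaivelyIsotropic := by
  obtain ⟨W'', h, hiso, hpre, hfull, -⟩ := R.exists_full_inclusion π W
  exact hfull (hW h hiso hpre)

/-! ### Step 1 for `R`: co-angularity of the Frobenius-type factor -/

/-- **Step 1 for `R`**: for a morphism of Frobenius type `β : X → X′` of `R`, the region of `X′`
pulled back along `Base(β₀)` has angular part INSIDE `(c_β/|c_β|) · B_X^{·deg β₀}`.
[cite: MochizukiFrdII2008, Prop 3.4 (ii) p.30] -/
theorem R.act_mem_product_of_isFrobeniusType {X X' : R π} (β : X ⟶ X')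
    (hβ : PreFrobenioid.IsFrobeniusType (R.toC π ⋙ C.toElem π) β) :
    ∀ y ∈ X'.fst.left.obj.obj.region.carrier,
      unitPart ℂ ((C0.Base (N0.homCarrier β.fst.left)).act y) ∈
        unitPart ℂ (C0.scalar (N0.homCarrier β.fst.left)) •
          X.fst.left.obj.obj.region.dir ^ (C0.degFr (N0.homCarrier β.fst.left) : ℕ) := by
  obtain ⟨rX, XD, ιX⟩ := X
  obtain ⟨rX', X'D, ιX'⟩ := X'
  obtain ⟨βO, βD, wβ⟩ := β
  obtain ⟨⟨hco, -⟩, hbi⟩ := hβ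
  haveI : IsIso βD := hbi
  let β₀ : rX.left.obj.obj ⟶ rX'.left.obj.obj := N0.homCarrier βO.left
  have hβiso : PreFrobenioid.IsIsometry C0.toElem β₀ := βO.left.hom.property
  have hβlin : C0.degFr β₀ = 1 := βO.left.property
  obtain ⟨Q, hQ, γ₀, ι₀, hQd, hQt, hfac, hγb, hιb, hιd, hιs, hιiso, hγiso⟩ := C0.exists_factor_product β₀
  have hdegγ : C0.degFr γ₀ = 1 := by
    have h := congrArg C0.degFr hfac
    rw [C0.degFr_comp', hιd, mul_one] at h
    exact h.trans hβlin
  let γN : rX.left ⟶ (⟨⟨C0.mk _ Q hQ⟩⟩ : N0) := N0.homMk γ₀ (hγiso hβiso) hdegγ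
  let ιN : (⟨⟨C0.mk _ Q hQ⟩⟩ : N0) ⟶ rX'.left := N0.homMk ι₀ hιiso hιd
  let r₃ : R0 := Over.mk (ιN ≫ rX'.hom)
  have hγw : γN ≫ ιN ≫ rX'.hom = rX.hom := by
    rw [← Category.assoc]
    have : γN ≫ ιN = βO.left := N0.hom_ext hfac
    rw [this]
    exact Over.w βO
  let γO : rX ⟶ r₃ := Over.homMk γN hγw
  let ιO : r₃ ⟶ rX' := Over.homMk ιN rfl
  let X₃ : R π := ⟨r₃, XD, ιX⟩
  have wγ : R0.toD0.map γO ≫ X₃.iso.hom = ιX.hom ≫ π.map (𝟙 XD) := by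
    change C0.Base γ₀ ≫ ιX.hom = ιX.hom ≫ π.map (𝟙 XD)
    rw [hγb, CategoryTheory.Functor.map_id, Category.id_comp, Category.comp_id]
  have wι : R0.toD0.map ιO ≫ ιX'.hom = X₃.iso.hom ≫ π.map βD := by
    change C0.Base ι₀ ≫ ιX'.hom = ιX.hom ≫ π.map βD
    rw [hιb]; exact wβ
  let γR : (⟨rX, XD, ιX⟩ : R π) ⟶ X₃ := ⟨γO, 𝟙 XD, wγ⟩
  let ιR : X₃ ⟶ (⟨rX', X'D, ιX'⟩ : R π) := ⟨ιO, βD, wι⟩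
  have hιRiso : PreFrobenioid.IsIsometry (R.toC π ⋙ C.toElem π) ιR := by
    change pull _ _ (PreFrobenioid.Div C0.toElem ι₀) = 1
    rw [show PreFrobenioid.Div C0.toElem ι₀ = 1 from hιiso, map_one]
  have hcomp : γR ≫ ιR ≫ 𝟙 _ = ⟨βO, βD, wβ⟩ := by
    rw [Category.comp_id]
    refine CFP.hom_ext (Over.OverMorphism.ext (N0.hom_ext ?_)) (Category.id_comp _)
    exact hfac
  have hιIso : IsIso ιR := by
    refine hco γR ιR (𝟙 _) hcomp rfl hιRiso ⟨hιd, ?_⟩ (Or.inr ?_)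
    · change IsIso βD; infer_instance
    · change IsIso (𝟙 XD); infer_instance
  haveI : IsIso ((R.toC π).map ιR) := by haveI := hιIso; infer_instance
  haveI : IsIso ι₀ := CFP.isIso_fst ((R.toC π).map ιR)
  intro y hy
  have hmem := C0.act_mem_carrier_of_isIso ι₀ hιd hιs hy
  rw [hιb] at hmem
  have h := ((C0.mk rX.left.obj.obj.base Q hQ).region.mem_carrier_polar_iff _).mp hmem
  change unitPart ℂ ((C0.Base β₀).act y) ∈ unitPart ℂ (C0.scalar β₀) • _ ^ (C0.degFr β₀ : ℕ)
  rw [← hQd]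
  exact h.1

/-! ### Steps 2–3 for `R` -/

/-- **Step 2 for `R`**: condition (b)'s hull clause leaves at most one direction out of `B_{X′}`.
[cite: MochizukiFrdII2008, Prop 3.4 (ii) p.30] -/
theorem R.compl_subset_dir_of_hulls (X' : R π)
    (hh : ∀ (X'' : R π) (h : X' ⟶ X''), PreFrobenioid.IsIsotropicHull (R.toC π ⋙ C.toElem π) h →
      IsIso h ∨ (towerR π).IsSlit h) :
    ∃ z : ↥(normOneSubgroup ℂ), ({z}ᶜ : Set ↥(normOneSubgroup ℂ)) ⊆ X'.fst.left.obj.obj.region.dir := by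
  obtain ⟨X'', h, -, -, hfull, hhull⟩ := R.exists_full_inclusion π X'
  have hHull := hhull (R.isNaivelyIsotropic_of_isIsotropic π)
  rcases hh X'' h hHull with hi | hslit
  · have hX := hfull hi
    refine ⟨1, fun w _ => ?_⟩
    change X'.fst.left.obj.obj.region.dir = univ at hX
    rw [hX]; exact mem_univ _
  · obtain ⟨z, hz⟩ := hslit.2
    change X'.fst.left.obj.obj.region.dir = {z}ᶜ at hz
    exact ⟨z, fun w hw => by rw [hz]; exact hw⟩

/-- **Steps 1–3 for `R`**: under condition (b), a translate of the `deg_Fr(φ)`-fold product of the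
angular part of `X` misses at most one point of `S¹`. [cite: MochizukiFrdII2008, Prop 3.4 (ii) p.30] -/
theorem R.compl_subset_of_condB {X Y : R π} (φ : X ⟶ Y) (hb : (towerR π).CondB φ) :
    ∃ (e q : ↥(normOneSubgroup ℂ)),
      ({q}ᶜ : Set ↥(normOneSubgroup ℂ)) ⊆
        e • X.fst.left.obj.obj.region.dir ^ (C0.degFr (N0.homCarrier φ.fst.left) : ℕ) := by
  obtain ⟨X', β, α, hfac, hFT, hlin, hhull⟩ := hb
  have hlin' : C0.degFr (N0.homCarrier α.fst.left) = 1 := hlin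
  have hdeg : C0.degFr (N0.homCarrier φ.fst.left) = C0.degFr (N0.homCarrier β.fst.left) := by
    rw [← hfac]
    change C0.degFr (N0.homCarrier β.fst.left ≫ N0.homCarrier α.fst.left) = _
    rw [C0.degFr_comp', hlin', mul_one]
  obtain ⟨z, hz⟩ := R.compl_subset_dir_of_hulls π X' hhull
  obtain ⟨q, hq⟩ := C0.compl_subset_of_act_mem (N0.homCarrier β.fst.left)
    (R.act_mem_product_of_isFrobeniusType π β hFT) hz
  exact ⟨unitPart ℂ (C0.scalar (N0.homCarrier β.fst.left)), q, by rw [hdeg]; exact hq⟩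

/-! ### Proposition 3.4 (ii) for `F = R` -/

/-- **Proposition 3.4 (ii) for the rigidified angloid `R`**, both conditions, AS TYPED.
[cite: MochizukiFrdII2008, Prop 3.4 (ii) p.30] -/
theorem R.propII : (towerR π).PropII := by
  intro X Y φ hφ hcond
  haveI := hφ
  refine ⟨fun {Zd} a b h => ?_⟩
  change a ≫ φ.snd = b ≫ φ.snd at h
  by_cases hab : π.map a = π.map b
  · -- abc-iut-L1-d3's argument for equal projections (as in `R.propII_condA`)
    obtain ⟨R', hR', ψ₀, hbψ, hd, -, hiso⟩ :=
      C0.exists_lift X.fst.left.obj.obj (π.map a ≫ X.iso.inv)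
    let g : (⟨⟨⟨_, R', hR'⟩⟩⟩ : N0) ⟶ X.fst.left := N0.homMk ψ₀ hiso hd
    let rZ : R0 := Over.mk (g ≫ X.fst.hom)
    let gO : rZ ⟶ X.fst := Over.homMk g rfl
    let Z' : R π := ⟨rZ, _, Iso.refl _⟩
    have hb' : R0.toD0.map gO = π.map a ≫ X.iso.inv := hbψ
    have wa : R0.toD0.map gO ≫ X.iso.hom = Z'.iso.hom ≫ π.map a :=
      ((Iso.eq_comp_inv X.iso).mp hb').trans (Category.id_comp _).symm
    have wb : R0.toD0.map gO ≫ X.iso.hom = Z'.iso.hom ≫ π.map b := wa.trans (by rw [hab])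
    have heq : (⟨gO, a, wa⟩ : Z' ⟶ X) ≫ φ = (⟨gO, b, wb⟩ : Z' ⟶ X) ≫ φ := CFP.hom_ext rfl h
    exact congrArg CFP.Hom.snd ((cancel_mono φ).mp heq)
  · have hb : (towerR π).CondB φ := by
      refine hcond.resolve_left fun ha => hab ?_
      exact map_eq_of_isIso_map π a b _ ha h
    obtain ⟨e, q, hbig⟩ := R.compl_subset_of_condB π φ hb
    obtain ⟨hZc, hXc⟩ := D0.eq_complex_of_ne hab
    have hYr : π.obj Y.snd = D0.real :=
      D0.eq_real_of_comp_eq hab (π.map φ.snd) (by rw [← Functor.map_comp, h, Functor.map_comp])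
    obtain ⟨rX, XD, ιX⟩ := X
    obtain ⟨rY, YD, ιY⟩ := Y
    obtain ⟨φO, φD, wφ⟩ := φ
    change XD ⟶ YD at φD
    change Zd ⟶ XD at a b
    change a ≫ φD = b ≫ φD at h
    change π.obj XD = D0.complex at hXc
    change π.obj YD = D0.real at hYr
    let X₀ : C0 := rX.left.obj.obj
    let Y₀ : C0 := rY.left.obj.obj
    let φ₀ : X₀ ⟶ Y₀ := N0.homCarrier φO.left
    have hKX : X₀.base = D0.complex := by
      haveI : IsIso ιX.hom := ιX.isIso_hom
      exact (D0.eq_of_isIso ιX.hom).trans hXc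
    have hKY : Y₀.base = D0.real := by
      haveI : IsIso ιY.hom := ιY.isIso_hom
      exact (D0.eq_of_isIso ιY.hom).trans hYr
    change ({q}ᶜ : Set ↥(normOneSubgroup ℂ)) ⊆ e • X₀.region.dir ^ (C0.degFr φ₀ : ℕ) at hbig
    obtain ⟨RZ, hRZ, a₀, b₀, ha₀b, hb₀b, ha₀d, hb₀d, ha₀i, hb₀i, hcomp₀⟩ :=
      C0.exists_conj_pair_of_compl_subset' X₀ Y₀ hKX hKY φ₀ hbig
    haveI : IsIso (π.map a) := D0.isIso_of_eq_complex _ hXc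
    let ea : π.obj Zd ≅ π.obj XD := asIso (π.map a)
    let Z₀ : C0 := C0.mk X₀.base RZ hRZ
    let ιZ : Z₀.base ≅ π.obj Zd := ιX ≪≫ ea.symm
    have wa : C0.Base a₀ ≫ ιX.hom = ιZ.hom ≫ π.map a := by
      rw [ha₀b]
      change 𝟙 _ ≫ ιX.hom = (ιX.hom ≫ ea.inv) ≫ ea.hom
      rw [Category.assoc, ea.inv_hom_id, Category.comp_id]
      exact Category.id_comp _
    have wb : C0.Base b₀ ≫ ιX.hom = ιZ.hom ≫ π.map b := by
      change C0.Base b₀ ≫ ιX.hom = (ιX.hom ≫ ea.inv) ≫ π.map b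
      have h1 : C0.Base b₀ ≫ ιX.hom ≠ ιX.hom := by
        intro hc
        have hid : C0.Base b₀ = 𝟙 _ :=
          (cancel_mono ιX.hom).mp (hc.trans (Category.id_comp ιX.hom).symm)
        have := congrArg D0.Hom.twists hid
        rw [hb₀b, D0.twists_id] at this
        exact Bool.noConfusion this
      have h2 : (ιX.hom ≫ ea.inv) ≫ π.map b ≠ ιX.hom := by
        intro hc
        apply hab
        rw [Category.assoc] at hc
        have h' : ea.inv ≫ π.map b = 𝟙 _ :=
          (cancel_epi ιX.hom).mp (hc.trans (Category.comp_id ιX.hom).symm)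
        have h'' := (Iso.inv_comp_eq ea).mp h'
        rw [Category.comp_id] at h''
        exact h''.symm
      exact D0.hom_eq_of_ne_of_ne h1 h2
    -- the two lifts as arrows of `R`: through the structure arrow of `X`
    let aN : (⟨⟨Z₀⟩⟩ : N0) ⟶ rX.left := N0.homMk a₀ ha₀i ha₀d
    let bN : (⟨⟨Z₀⟩⟩ : N0) ⟶ rX.left := N0.homMk b₀ hb₀i hb₀d
    -- the two structure arrows `Z → [ℝ-unit]` agree: both factor through `φ₀ a₀ = φ₀ b₀` (`φ` lies over `X → Y → [ℝ-unit]`)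
    have hstr : aN ≫ rX.hom = bN ≫ rX.hom := by
      rw [← Over.w φO, ← Category.assoc, ← Category.assoc]
      congr 1
      exact N0.hom_ext hcomp₀
    let rZ : R0 := Over.mk (aN ≫ rX.hom)
    let aO : rZ ⟶ rX := Over.homMk aN rfl
    let bO : rZ ⟶ rX := Over.homMk bN hstr.symm
    let ZR : R π := ⟨rZ, Zd, ιZ⟩
    let aR : ZR ⟶ ⟨rX, XD, ιX⟩ := ⟨aO, a, wa⟩
    let bR : ZR ⟶ ⟨rX, XD, ιX⟩ := ⟨bO, b, wb⟩
    have heq : aR ≫ ⟨φO, φD, wφ⟩ = bR ≫ ⟨φO, φD, wφ⟩ := by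
      refine CFP.hom_ext (Over.OverMorphism.ext (N0.hom_ext ?_)) h
      change a₀ ≫ φ₀ = b₀ ≫ φ₀
      exact hcomp₀
    exact congrArg CFP.Hom.snd (hφ.right_cancellation _ _ heq)

/-! ### Proposition 3.4 (ii) for `F = A, N, R` -/

/-- **Proposition 3.4 (ii)** PROVED AS TYPED, for `F = A, N, R` (FrdII p. 30): a monomorphism of `F`
satisfying (a) or (b) projects to a monomorphism of `D` — node `FrdII:Prop3.4(ii)` of the cell's
SUBDAG-FrdII-Prop34 (condition (a): abc-iut-L1-d3, `ArchimedeanFSMMono.lean`; condition (b): sub-rows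
P34-L02/L03, these files). [cite: MochizukiFrdII2008, Prop 3.4 (ii) p.30] -/
theorem prop34_ii_holds : Prop34_ii π :=
  ⟨A.propII π, N.propII π, R.propII π⟩

/-- `Prop34_ii` — `_holds` alias of `prop34_ii_holds` above under the fact's exact name (appended
2026-08-28, D-0026 bookkeeping: the proof term is the existing theorem of this file; no statement,
definition or attribute is edited; no new named fact; the ledger's debt table listed the fact
unproved). [cite: MochizukiFrdII2008, Prop 3.4 (ii) p.30] -/
theorem _root_.Literature.AlgebraicGeometry.Frobenioids.ArchFrd.Prop34_ii_holds : Prop34_ii π :=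
  _root_.Literature.AlgebraicGeometry.Frobenioids.ArchFrd.prop34_ii_holds (π := π)

end ArchFrd

end

end Literature.AlgebraicGeometry.Frobenioids
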